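/-
Copyright (c) 2026 the pub-hodgecm-mathlib formalisation cell (harness21).  Prover seat hodgecm-mathlib-LH7-p05 (g3), Track B «K2-LIT» ∕ hLiu418 #184♮ =
`stmt-HodgeConjecture-24832`, socket #41 KIND 1 a♮ (dec) in the `D`-currency: FILE 2 of the (L3-den) deal (K1a DESK WORD #2 (1), K2Liu-p01 (g11), 2026-09-05T02:08Z)
— «THE FINITE HEAD `∏_{v∈T S h} Gn` IS POLYNOMIALLY BOUNDED, GIVEN ONE PER-PLACE SIZE LETTER» (★ p864440's `hGnb` slot, K2E4-p10 (g10)).  THEOREMS ONLY (no `def`,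
no `instance`, no notation, no named-fact hypothesis, no `sorry`); lane `--supports stmt-HodgeConjecture-24832 --as helper`.
-/
import Summits.HodgeConjecture.HodgeConjecture.Theorems.K2LiuKindWPlacesProduct                 -- ★ p864539 (L3-den) FILE 1 (this seat): `prod_residueCard_kindWFinset_sdiff_le`, `prod_union_le_of_one_le`, `prod_absNorm_le_pow_of_natCast`
import Summits.HodgeConjecture.HodgeConjecture.Theorems.K2LiuCornerScalarPoleCount              -- ★ p864275 + ED. 2 p864391 (this seat): `exists_cornerScalar_den_pole_count`, `exists_cornerScalar_tau_letters`
import Summits.HodgeConjecture.HodgeConjecture.Theorems.K2LiuKindOneSingularShellCount          -- ★ p864306 (C-d) (K2Liu-p03): `inv_single_eq_zero` (+ the height bricks in its closure)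
import Summits.HodgeConjecture.HodgeConjecture.Theorems.K2LiuSiegelEisensteinKindWFinitePlaces   -- ★ FILE 2c: `prod_pow_absNorm_le_abs_norm_of_valuation_le`, `abs_norm_le_pow_of_apply_le`
import Summits.HodgeConjecture.HodgeConjecture.Theorems.K2LiuKindWFinitePartLettersOfRecord      -- ★ `prod_placesOver_eq_prod_biUnion`, `valuation_le_one_of_isIntegral`
import HarnessLib

/-!
# Crux `HLiu418`, socket #41, KIND 1 a♮ (dec) — `K2LiuKindOneSingularFiniteHeadBound`: THE (L3-den) FINITE-HEAD SIZE LETTER FROM ONE PER-PLACE SIZE LETTER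

Cell `hodgecm-mathlib`, crux item hLiu418 = `stmt-HodgeConjecture-24832` (helper lane, count-neutral).  Namespace `…Cruxes.HLiu418.K2LiuKindOneSingularFiniteHeadBound`.
WHY.  ★ p864440∕den₂ `hdec_of_factorBounds_den` (K2E4-p10) takes the (L3-den) letter `hGnb` BY VALUE (`‖∏_{v∈T S h} Gn S i v s h‖ ≤ C·‖h‖^a·(1+τa S)^{N₂}·d^{Nd₂}` near every
`z`, `0 < re z`).  LOC-FACE's ★ heads (p863501 and kin) give `q_v^{−s}`-rationality and regularity of each `Gn`, NO SIZE — so this is the ASSEMBLER, hypothesis-first on ONE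
per-place size letter `hGnv` (K1a DESK WORD #2 (1), K2Liu-p01 (g11), 2026-09-05T02:08Z; «L3: missing = the per-place size letter», LOC-FACE's named growth slot):
`‖Gn S i v s h‖ ≤ (q_v^{mτ S v + 1} · ∏_{w∣v} H_w(gc S·h))^M` — polynomial in `q_v`, in the `τ`-conductor exponent `mτ S v`, and in the local heights of the translate above `v`.
PROOF: `‖∏ Gn‖ ≤ [∏_T q_v^{mτ} · ∏_T q_v · ∏_T ∏_{w∣v} H_w]^M`; `∏_T∏_{w∣v} H_w ≤ ∏ᶠ_w H_w(gc S·h) ≤ 4‖gc S·h‖ ≤ 4·4C₀(d(1+τa S))^{2k₁[L:ℚ]}‖h‖` (★ (C-d)'s translate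
chain); `∏_T q_v^{mτ} ≤ |N((d d₀)τ)| ≤ (d d₀(Cτ+1)(1+τa S))^{[L⁺:ℚ]}` (★ FILE 2c + ★ ED. 2 `exists_cornerScalar_tau_letters`); `∏_T q_v ≤ (∏_{T₀∪Trec} q_v)(d d₀)^{[L⁺:ℚ]}·
(∏ᶠ H_w(gc S·h))(∏ᶠ H_w(w_Δ))(d d₁)^{2[L:ℚ]}` (★ p864539 FILE 1 + ★ ED. 1 `exists_cornerScalar_den_pole_count`).  Tie adapter for the `∀ i : Fin m` slot shape:
`I := fun _ _ => Finset.univ`, then `fun … i => hb … i (Finset.mem_univ i)`.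
References: [KudlaRallis1994, §2 (2.10)–(2.12)]; [BorelJacquet1979, §1.2]; [MoeglinWaldspurger1995, I.2.2, II.1.7]; [NeukirchANT1999, Ch. I §6 Prop. (6.1), §8, Ch. III §1];
[Shimura1997, §18.4 Prop. 18.14].  HONEST LABEL: HC_CM is proved only modulo the 7 printed citations (2 remaining named inputs: hLiu418 = stmt-HodgeConjecture-24832,
h413 = stmt-HodgeConjecture-24833) until rung 0 closes; count-neutral helper (`--supports stmt-HodgeConjecture-24832 --as helper`); the per-place size letter stays BY VALUE.
-/

set_option autoImplicit false
set_option linter.dupNamespace false -- the mandated namespace repeats `HodgeConjecture.HodgeConjecture`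

noncomputable section

open scoped Matrix NNReal MatrixGroups
open NumberField IsDedekindDomain

namespace Summit.HodgeConjecture.HodgeConjecture.Cruxes.HLiu418.K2LiuKindOneSingularFiniteHeadBound

open Literature.NumberTheory.Automorphic Literature.NumberTheory.Automorphic.UnitaryGroup Literature.NumberTheory.GaloisRepresentations
open Literature.NumberTheory.GelbartRogawski1991 Literature.NumberTheory.GelbartRogawski1991.GRConstruction
open Literature.NumberTheory.GelbartRogawski1991.AdaptedBlocks
open Literature.NumberTheory.GelbartRogawski1991.UnitaryDualPair
open Literature.NumberTheory.K2Lit.SiegelDoubled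
open Summit.HodgeConjecture.HodgeConjecture.Cruxes.HLiu418.K2LiuSiegelUnipotentLocalDefs
open Summit.HodgeConjecture.HodgeConjecture.Cruxes.HLiu418.K2LiuSiegelUnipotentSplitDefs
open Summit.HodgeConjecture.HodgeConjecture.Cruxes.HLiu418.K2LiuSiegelUnipotentSplitAtDefs
open Summit.HodgeConjecture.HodgeConjecture.Cruxes.HLiu418.K2LiuSiegelUnipotentFourierDefs
open Summit.HodgeConjecture.HodgeConjecture.Cruxes.HLiu418.K2LiuSiegelEisensteinKindWLetters
open Summit.HodgeConjecture.HodgeConjecture.Cruxes.HLiu418.K2LiuKindWPlacesCount (prod_le_finprod_of_one_le)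
open Summit.HodgeConjecture.HodgeConjecture.Cruxes.HLiu418.K2LiuKindWPlacesProduct
  (prod_residueCard_kindWFinset_sdiff_le prod_union_le_of_one_le prod_absNorm_le_pow_of_natCast)
open Summit.HodgeConjecture.HodgeConjecture.Cruxes.HLiu418.K2LiuCornerScalarPoleCount (exists_cornerScalar_den_pole_count exists_cornerScalar_tau_letters)
open Summit.HodgeConjecture.HodgeConjecture.Cruxes.HLiu418.K2LiuKindOneSingularShellCount (inv_single_eq_zero)
open Summit.HodgeConjecture.HodgeConjecture.Cruxes.HLiu418.K2LiuKindOneLineTranslateHeight (adelicHeightGL_leviRow_translate_le)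
open Summit.HodgeConjecture.HodgeConjecture.Cruxes.HLiu418.K2LiuRowSectionHeightLeVecHeight (exists_adelicHeightGL_rowSection_le)
open Summit.HodgeConjecture.HodgeConjecture.Cruxes.HLiu418.K2LiuVecHeightVsMulHeight (exists_vecHeight_principalVec_le_mulHeight_pow)
open Summit.HodgeConjecture.HodgeConjecture.Cruxes.HLiu418.K2LiuLeviHomHeightBound (exists_adelicHeightGL_leviHom_le_sq)
open Summit.HodgeConjecture.HodgeConjecture.Cruxes.HLiu418.K2LiuClosedSubgroupHeightBallVolume (finprod_localHeight_le_mul_adelicHeightGL)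
open Summit.HodgeConjecture.HodgeConjecture.Cruxes.HLiu418.K2LiuSiegelEisensteinKindWFinitePlaces
  (prod_pow_absNorm_le_abs_norm_of_valuation_le abs_norm_le_pow_of_apply_le)
open Summit.HodgeConjecture.HodgeConjecture.Cruxes.HLiu418.K2LiuKindWFinitePartLettersOfRecord (prod_placesOver_eq_prod_biUnion valuation_le_one_of_isIntegral)

variable (L : Type) [Field L] [NumberField L] [IsCMField L]

section Head

variable {N M : ℕ} (e : Fin N × Fin M ≃ Fin 2)
  (dV : Fin N → L) (hdV : ∀ i, IsCMField.complexConj L (dV i) = dV i)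
  (dW : Fin M → L) (hdW : ∀ i, IsCMField.complexConj L (dW i) = dW i)
  [DecidableEq (HeightOneSpectrum (𝓞 (Fp L)))]

set_option maxHeartbeats 800000 in -- MEASURED class of ★ p864221∕★ p864539 heads: the `HA`∕`PlacesOver`∕`kindWFinset` telescope in `hGnv` and the head times out `whnf` at the default
open Classical in -- the archimedean size `‖(ι_∞ S_ab)_ab‖` is read with the consumers' instances (★ p863404 ∕ ★ p864122 ∕ ★ p864440: `open Classical in`)
/-- **(K1a-dec)(L3-den) THE FINITE-HEAD SIZE LETTER FROM ONE PER-PLACE SIZE LETTER.**  DATA by value as for ★ (C-d) p864306 (`Λ hΛ γ hnorm T₀ Trec σc gc T mτ u w hw Tp`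
+ (f) `hgc` (g) `hpres` (h1) `hTeq` (h2) `hTp` (h5) `hmτ` of ★ (A) p864217), the tensor index `I`, the local letters `Gn` (★ (A)'s `W`), THE PER-PLACE SIZE LETTER `hGnv`
(LOC-FACE's named growth slot), the size `τa hτa`.  THEN ★ p864440's `hGnb` letter at `n = 2`.  [cite: KudlaRallis1994, §2 (2.10)–(2.12)] [cite: BorelJacquet1979, §1.2]
[cite: MoeglinWaldspurger1995, I.2.2, II.1.7] [cite: NeukirchANT1999, Ch. I §6 Prop. (6.1); §8; Ch. III §1] [cite: Shimura1997, §18.4 Prop. 18.14] -/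
theorem hGnb_of_placeBounds (hdV0 : ∀ i, dV i ≠ 0) (hdW0 : ∀ i, dW i ≠ 0)
    (Λ : GL (Fin 2) (AdeleRing (𝓞 L) L) →* HA L e dV hdV dW hdW)
    (hΛ : ∀ g : GL (Fin 2) (AdeleRing (𝓞 L) L), blk L e dV hdV dW hdW (Λ g) =
      cayR (AdeleRing (𝓞 L) L) (Fin 2) * Matrix.fromBlocks (g : Matrix (Fin 2) (Fin 2) (AdeleRing (𝓞 L) L)) 0 0
        (((gramR L e dV hdV dW hdW).map ((algebraMap L (AdeleRing (𝓞 L) L)).comp (algebraMap (Fp L) L)))⁻¹ *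
          (((g⁻¹ : GL (Fin 2) (AdeleRing (𝓞 L) L)) : Matrix (Fin 2) (Fin 2) (AdeleRing (𝓞 L) L)).map
            (conjAdele (Fp L) L (IsCMField.complexConj L)))ᵀ *
          (gramR L e dV hdV dW hdW).map ((algebraMap L (AdeleRing (𝓞 L) L)).comp (algebraMap (Fp L) L))) *
        cayRinv (AdeleRing (𝓞 L) L) (Fin 2))
    (γ : Projectivization L (Fin 2 → L) → GL (Fin 2) L)
    (hnorm : ∀ (w : Fin 2 → L) (hw : w ≠ 0), ∃ i : Fin 2, w i ≠ 0 ∧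
      (γ (Projectivization.mk L w hw) : Matrix (Fin 2) (Fin 2) L) 1 = (w i)⁻¹ • w ∧
      ∀ a b : Fin 2,
        (∃ k : Fin 2, (γ (Projectivization.mk L w hw) : Matrix (Fin 2) (Fin 2) L) a b = 0 ∨
          (γ (Projectivization.mk L w hw) : Matrix (Fin 2) (Fin 2) L) a b = 1 ∨
          (γ (Projectivization.mk L w hw) : Matrix (Fin 2) (Fin 2) L) a b = (w i)⁻¹ * w k ∨
          (γ (Projectivization.mk L w hw) : Matrix (Fin 2) (Fin 2) L) a b = -((w i)⁻¹ * w k)) ∧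
        (∃ k : Fin 2, (((γ (Projectivization.mk L w hw))⁻¹ : GL (Fin 2) L) : Matrix (Fin 2) (Fin 2) L) a b = 0 ∨
          (((γ (Projectivization.mk L w hw))⁻¹ : GL (Fin 2) L) : Matrix (Fin 2) (Fin 2) L) a b = 1 ∨
          (((γ (Projectivization.mk L w hw))⁻¹ : GL (Fin 2) L) : Matrix (Fin 2) (Fin 2) L) a b = (w i)⁻¹ * w k ∨
          (((γ (Projectivization.mk L w hw))⁻¹ : GL (Fin 2) L) : Matrix (Fin 2) (Fin 2) L) a b = -((w i)⁻¹ * w k)))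
    (T₀ Trec : Finset (HeightOneSpectrum (𝓞 (Fp L))))
    (σc : skewMatrices ((IsCMField.complexConj L : L ≃ₐ[Fp L] L) : L →+* L) ((gramR L e dV hdV dW hdW).map (algebraMap (Fp L) L)) → L)
    (gc : skewMatrices ((IsCMField.complexConj L : L ≃ₐ[Fp L] L) : L →+* L) ((gramR L e dV hdV dW hdW).map (algebraMap (Fp L) L)) → HA L e dV hdV dW hdW)
    (T : skewMatrices ((IsCMField.complexConj L : L ≃ₐ[Fp L] L) : L →+* L) ((gramR L e dV hdV dW hdW).map (algebraMap (Fp L) L)) → HA L e dV hdV dW hdW →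
      Finset (HeightOneSpectrum (𝓞 (Fp L))))
    (mτ : skewMatrices ((IsCMField.complexConj L : L ≃ₐ[Fp L] L) : L →+* L) ((gramR L e dV hdV dW hdW).map (algebraMap (Fp L) L)) → HeightOneSpectrum (𝓞 (Fp L)) → ℕ)
    (u w : skewMatrices ((IsCMField.complexConj L : L ≃ₐ[Fp L] L) : L →+* L) ((gramR L e dV hdV dW hdW).map (algebraMap (Fp L) L)) → Fin 2 → L)
    (hw : ∀ S, w S ≠ 0)
    (Tp : skewMatrices ((IsCMField.complexConj L : L ≃ₐ[Fp L] L) : L →+* L) ((gramR L e dV hdV dW hdW).map (algebraMap (Fp L) L)) → Finset (HeightOneSpectrum (𝓞 (Fp L))))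
    (hgc : ∀ S, gc S = Λ (Matrix.GeneralLinearGroup.map (algebraMap L (AdeleRing (𝓞 L) L)) (γ (Projectivization.mk L (w S) (hw S)))))
    (hpres : ∀ S : skewMatrices ((IsCMField.complexConj L : L ≃ₐ[Fp L] L) : L →+* L) ((gramR L e dV hdV dW hdW).map (algebraMap (Fp L) L)),
      (S : Matrix (Fin 2) (Fin 2) L) ≠ 0 → (S : Matrix (Fin 2) (Fin 2) L).det = 0 →
        (S : Matrix (Fin 2) (Fin 2) L) = Matrix.vecMulVec (u S) (w S) ∧
        (∀ k : Fin 2, ((gramR L e dV hdV dW hdW).map (algebraMap (Fp L) L)) k k * (S : Matrix (Fin 2) (Fin 2) L) k k =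
          IsCMField.complexConj L (((γ (Projectivization.mk L (w S) (hw S)) : GL (Fin 2) L) : Matrix (Fin 2) (Fin 2) L) 1 k) *
            ((gramR L e dV hdV dW hdW).map (algebraMap (Fp L) L)) 1 1 * σc S * ((γ (Projectivization.mk L (w S) (hw S)) : GL (Fin 2) L) : Matrix (Fin 2) (Fin 2) L) 1 k) ∧
        gramR L e dV hdV dW hdW 1 1 * Algebra.trace (Fp L) L (σc S * imagUnit L) ≠ 0)
    (hTeq : ∀ S (h : HA L e dV hdV dW hdW), T S h = kindWFinset L e dV hdV dW hdW (T₀ ∪ Tp S) (Matrix.single 1 1 (σc S)) (gc S * h))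
    (hTp : ∀ S (v : HeightOneSpectrum (𝓞 (Fp L))), v ∈ Tp S ↔
      v ∈ Trec ∨ 1 < Valued.v (algebraMap (Fp L) (v.adicCompletion (Fp L)) (gramR L e dV hdV dW hdW 1 1 * Algebra.trace (Fp L) L (σc S * imagUnit L))))
    (hmτ : ∀ S (v : HeightOneSpectrum (𝓞 (Fp L))),
      mτ S v = (-WithZero.log (Valued.v (algebraMap (Fp L) (v.adicCompletion (Fp L)) (gramR L e dV hdV dW hdW 1 1 * Algebra.trace (Fp L) L (σc S * imagUnit L))))).toNat)
    {ι' : Type*} (I : skewMatrices ((IsCMField.complexConj L : L ≃ₐ[Fp L] L) : L →+* L) ((gramR L e dV hdV dW hdW).map (algebraMap (Fp L) L)) → HA L e dV hdV dW hdW → Finset ι')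
    (Gn : skewMatrices ((IsCMField.complexConj L : L ≃ₐ[Fp L] L) : L →+* L) ((gramR L e dV hdV dW hdW).map (algebraMap (Fp L) L)) → ι' →
      HeightOneSpectrum (𝓞 (Fp L)) → ℂ → HA L e dV hdV dW hdW → ℂ)
    (hGnv : ∀ z : ℂ, 0 < z.re → ∃ (Mv : ℕ) (r : ℝ), 0 < r ∧
      ∀ (S : skewMatrices ((IsCMField.complexConj L : L ≃ₐ[Fp L] L) : L →+* L) ((gramR L e dV hdV dW hdW).map (algebraMap (Fp L) L))) (s : ℂ), dist s z < r →
      ∀ h : HA L e dV hdV dW hdW, (S : Matrix (Fin 2) (Fin 2) L) ≠ 0 → (S : Matrix (Fin 2) (Fin 2) L).det = 0 → ∀ i ∈ I S h, ∀ v ∈ T S h,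
        ‖Gn S i v s h‖ ≤ ((((v.residueCard : ℕ) : ℝ) ^ (mτ S v + 1)) *
          ∏ w' : UnitaryGroup.PlacesOver L v, (GLn.localHeight (2 + 2) L w'.1 ((gc S * h : HA L e dV hdV dW hdW) : GL (Fin (2 + 2)) (AdeleRing (𝓞 L) L)) : ℝ)) ^ Mv)
    (τa : skewMatrices ((IsCMField.complexConj L : L ≃ₐ[Fp L] L) : L →+* L) ((gramR L e dV hdV dW hdW).map (algebraMap (Fp L) L)) → ℝ)
    (hτa : ∀ S : skewMatrices ((IsCMField.complexConj L : L ≃ₐ[Fp L] L) : L →+* L) ((gramR L e dV hdV dW hdW).map (algebraMap (Fp L) L)),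
      ‖(fun i j => NumberField.mixedEmbedding L ((S : Matrix (Fin 2) (Fin 2) L) i j))‖ ≤ τa S) :
    ∀ z : ℂ, 0 < z.re → ∃ (N₂ Nd₂ : ℕ) (C a r : ℝ), 0 ≤ C ∧ 0 ≤ a ∧ 0 < r ∧
      ∀ (S : skewMatrices ((IsCMField.complexConj L : L ≃ₐ[Fp L] L) : L →+* L) ((gramR L e dV hdV dW hdW).map (algebraMap (Fp L) L))) (s : ℂ), dist s z < r →
      ∀ h : HA L e dV hdV dW hdW, (S : Matrix (Fin 2) (Fin 2) L) ≠ 0 → (S : Matrix (Fin 2) (Fin 2) L).det = 0 →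
      ∀ d : ℕ, 1 ≤ d → (∀ i j, IsIntegral ℤ ((d : L) * (S : Matrix (Fin 2) (Fin 2) L) i j)) → ∀ i ∈ I S h,
      ‖∏ v ∈ T S h, Gn S i v s h‖ ≤ C * adelicHeightGL (2 + 2) L (h : GL (Fin (2 + 2)) (AdeleRing (𝓞 L) L)) ^ a * (1 + τa S) ^ N₂ * (d : ℝ) ^ Nd₂ := by
  intro z hz
  obtain ⟨Mv, r, hr, hGn⟩ := hGnv z hz
  obtain ⟨d₁, hd₁, hden⟩ := exists_cornerScalar_den_pole_count L e dV hdV dW hdW hdV0 hdW0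
  obtain ⟨d₀, Cτ, hd₀, hCτ, hτ⟩ := exists_cornerScalar_tau_letters L e dV hdV dW hdW hdV0 hdW0
  obtain ⟨C₁, k₁, hC₁, hBi⟩ := exists_vecHeight_principalVec_le_mulHeight_pow (K := L) (ι := Fin 2)
  obtain ⟨C₂, hC₂, hBii⟩ := exists_adelicHeightGL_rowSection_le L
  obtain ⟨C₃, hC₃, hBiii⟩ := exists_adelicHeightGL_leviHom_le_sq L e dV hdV dW hdW hdV0 hdW0 Λ hΛ
  have hclause : ∀ (w' : Fin 2 → L) (hw' : w' ≠ 0),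
      adelicHeightGL (2 + 2) L ((fun g : GL (Fin 2) (AdeleRing (𝓞 L) L) => ((Λ g : HA L e dV hdV dW hdW) : GL (Fin (2 + 2)) (AdeleRing (𝓞 L) L)))
        (Matrix.GeneralLinearGroup.map (algebraMap L (AdeleRing (𝓞 L) L)) (γ (Projectivization.mk L w' hw')))) ≤
        (C₃ * (C₂ * C₁) ^ 2) * Height.mulHeight w' ^ (2 * k₁) := by
    intro w' hw'
    obtain ⟨i, hi, -, hent⟩ := hnorm w' hw'
    have h12 : adelicHeightGL 2 L (Matrix.GeneralLinearGroup.map (algebraMap L (AdeleRing (𝓞 L) L)) (γ (Projectivization.mk L w' hw'))) ≤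
        C₂ * C₁ * Height.mulHeight w' ^ k₁ :=
      calc adelicHeightGL 2 L (Matrix.GeneralLinearGroup.map (algebraMap L (AdeleRing (𝓞 L) L)) (γ (Projectivization.mk L w' hw')))
          ≤ C₂ * ((vecHeight L (principalVec L w') : ℝ≥0) : ℝ) := hBii w' i hi _ hent
        _ ≤ C₂ * (C₁ * Height.mulHeight w' ^ k₁) := mul_le_mul_of_nonneg_left (hBi w' hw') hC₂
        _ = C₂ * C₁ * Height.mulHeight w' ^ k₁ := by ring
    have h0 : 0 ≤ adelicHeightGL 2 L (Matrix.GeneralLinearGroup.map (algebraMap L (AdeleRing (𝓞 L) L)) (γ (Projectivization.mk L w' hw'))) :=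
      adelicHeightGL_nonneg _
    calc adelicHeightGL (2 + 2) L ((Λ (Matrix.GeneralLinearGroup.map (algebraMap L (AdeleRing (𝓞 L) L)) (γ (Projectivization.mk L w' hw'))) :
            HA L e dV hdV dW hdW) : GL (Fin (2 + 2)) (AdeleRing (𝓞 L) L))
        ≤ C₃ * adelicHeightGL 2 L (Matrix.GeneralLinearGroup.map (algebraMap L (AdeleRing (𝓞 L) L)) (γ (Projectivization.mk L w' hw'))) ^ 2 := hBiii _
      _ ≤ C₃ * (C₂ * C₁ * Height.mulHeight w' ^ k₁) ^ 2 := mul_le_mul_of_nonneg_left (pow_le_pow_left₀ h0 h12 2) hC₃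
      _ = (C₃ * (C₂ * C₁) ^ 2) * Height.mulHeight w' ^ (2 * k₁) := by ring
  have hC₀ : 0 ≤ C₃ * (C₂ * C₁) ^ 2 := by positivity
  set HΔ : ℝ := ∏ᶠ w', (GLn.localHeight (2 + 2) L w' ((weylDelta L e dV hdV dW hdW : HA L e dV hdV dW hdW) : GL (Fin (2 + 2)) (AdeleRing (𝓞 L) L)) : ℝ) with hHΔ
  have hHΔ0 : 0 ≤ HΔ := finprod_nonneg fun _ => NNReal.coe_nonneg _
  set Qrec : ℝ := ∏ v ∈ T₀ ∪ Trec, ((v.residueCard : ℕ) : ℝ) with hQrec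
  have hQrec1 : 1 ≤ Qrec :=
    calc (1 : ℝ) = ∏ _v ∈ T₀ ∪ Trec, (1 : ℝ) := Finset.prod_const_one.symm
      _ ≤ Qrec := Finset.prod_le_prod (fun _ _ => zero_le_one) fun v _ => by exact_mod_cast v.one_lt_residueCard.le
  set nL : ℕ := Module.finrank ℚ L with hnL
  set nF : ℕ := Module.finrank ℚ (Fp L) with hnF
  set kk : ℕ := nL * (2 * k₁) with hkk
  set Cst : ℝ := Qrec * HΔ * (d₀ : ℝ) ^ nF * (d₁ : ℝ) ^ (2 * nL) * ((d₀ : ℝ) * (Cτ + 1)) ^ nF *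
    ((((2 + 2 : ℕ) : ℝ) * (((2 + 2 : ℕ) : ℝ) * (C₃ * (C₂ * C₁) ^ 2))) ^ 2) with hCst
  have hCst0 : 0 ≤ Cst := by positivity
  refine ⟨Mv * (nF + 2 * kk), Mv * (2 * nF + 2 * nL + 2 * kk), Cst ^ Mv, ((2 * Mv : ℕ) : ℝ), r, by positivity, by positivity, hr,
    fun S s hs h hS0 hdet d hd hdS i hi => ?_⟩
  obtain ⟨hS1, hdiag, hτ0⟩ := hpres S hS0 hdet
  obtain ⟨ip, hip, hrow, -⟩ := hnorm (w S) (hw S)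
  have hd0 : d ≠ 0 := by omega
  have hdd₀ : d * d₀ ≠ 0 := mul_ne_zero hd0 hd₀
  have hdd₁ : d * d₁ ≠ 0 := mul_ne_zero hd0 hd₁
  have h1i : ((γ (Projectivization.mk L (w S) (hw S)) : GL (Fin 2) L) : Matrix (Fin 2) (Fin 2) L) 1 ip = 1 := by
    rw [hrow, Pi.smul_apply, smul_eq_mul, inv_mul_cancel₀ hip]
  have hpiv : ((gramR L e dV hdV dW hdW).map (algebraMap (Fp L) L)) ip ip * (S : Matrix (Fin 2) (Fin 2) L) ip ip =
      ((gramR L e dV hdV dW hdW).map (algebraMap (Fp L) L)) 1 1 * σc S := by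
    rw [hdiag ip, h1i, map_one, one_mul, mul_one]
  obtain ⟨hσint, -⟩ := hden (σc S) ((S : Matrix (Fin 2) (Fin 2) L) ip ip) ip d hd0 (hdS ip ip) hpiv
  obtain ⟨hyint, harch⟩ := hτ (σc S) ((S : Matrix (Fin 2) (Fin 2) L) ip ip) ip d hd0 (hdS ip ip) hpiv
  set Hh : ℝ := adelicHeightGL (2 + 2) L (h : GL (Fin (2 + 2)) (AdeleRing (𝓞 L) L)) with hHh
  have hHh0 : 0 ≤ Hh := adelicHeightGL_nonneg _
  have hτa0 : 0 ≤ τa S := (norm_nonneg _).trans (hτa S)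
  set t : ℝ := 1 + τa S with ht
  have ht1 : 1 ≤ t := by rw [ht]; linarith
  set Fg : ℝ := ∏ᶠ w', (GLn.localHeight (2 + 2) L w' ((gc S * h : HA L e dV hdV dW hdW) : GL (Fin (2 + 2)) (AdeleRing (𝓞 L) L)) : ℝ) with hFg
  have hFg0 : 0 ≤ Fg := finprod_nonneg fun _ => NNReal.coe_nonneg _
  set Fb : ℝ := ((2 + 2 : ℕ) : ℝ) * ((((2 + 2 : ℕ) : ℝ) * (C₃ * (C₂ * C₁) ^ 2)) * ((d : ℝ) * t) ^ kk * Hh) with hFb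
  have hS' : Matrix.vecMulVec (u S) (w S) ≠ 0 := hS1 ▸ hS0
  have hint' : ∀ a b, IsIntegral ℤ ((d : L) * Matrix.vecMulVec (u S) (w S) a b) := fun a b => by rw [← hS1]; exact hdS a b
  have htr := adelicHeightGL_leviRow_translate_le L
    (fun g : GL (Fin 2) (AdeleRing (𝓞 L) L) => ((Λ g : HA L e dV hdV dW hdW) : GL (Fin (2 + 2)) (AdeleRing (𝓞 L) L))) γ hC₀ hclause
    (u S) (w S) (hw S) hS' hd hint' (h : GL (Fin (2 + 2)) (AdeleRing (𝓞 L) L))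
  have hgh : ((gc S * h : HA L e dV hdV dW hdW) : GL (Fin (2 + 2)) (AdeleRing (𝓞 L) L)) =
      ((Λ (Matrix.GeneralLinearGroup.map (algebraMap L (AdeleRing (𝓞 L) L)) (γ (Projectivization.mk L (w S) (hw S)))) : HA L e dV hdV dW hdW) :
        GL (Fin (2 + 2)) (AdeleRing (𝓞 L) L)) * (h : GL (Fin (2 + 2)) (AdeleRing (𝓞 L) L)) := by
    rw [hgc S]; rfl
  have hF : Fg ≤ Fb := by
    rw [hFg, hFb]
    refine (finprod_localHeight_le_mul_adelicHeightGL _).trans (mul_le_mul_of_nonneg_left ?_ (Nat.cast_nonneg _))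
    rw [hgh]
    have h1τ : (d : ℝ) * (1 + ‖(fun a b => NumberField.mixedEmbedding L (Matrix.vecMulVec (u S) (w S) a b))‖) ≤ (d : ℝ) * t := by
      rw [ht]
      have hτ' : ‖(fun a b => NumberField.mixedEmbedding L (Matrix.vecMulVec (u S) (w S) a b))‖ ≤ τa S := by rw [← hS1]; exact hτa S
      exact mul_le_mul_of_nonneg_left (by linarith) (Nat.cast_nonneg d)
    rw [hkk, hHh]
    exact htr.trans (mul_le_mul_of_nonneg_right (mul_le_mul_of_nonneg_left (pow_le_pow_left₀ (by positivity) h1τ _) (by positivity)) hHh0)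
  have hFb0 : 0 ≤ Fb := hFg0.trans hF
  set τ : Fp L := gramR L e dV hdV dW hdW 1 1 * Algebra.trace (Fp L) L (σc S * imagUnit L) with hτdef
  have hX3 : ∏ v ∈ T S h, ∏ w' : UnitaryGroup.PlacesOver L v,
      (GLn.localHeight (2 + 2) L w'.1 ((gc S * h : HA L e dV hdV dW hdW) : GL (Fin (2 + 2)) (AdeleRing (𝓞 L) L)) : ℝ) ≤ Fg := by
    rw [prod_placesOver_eq_prod_biUnion L (T S h)
      (fun w' => (GLn.localHeight (2 + 2) L w' ((gc S * h : HA L e dV hdV dW hdW) : GL (Fin (2 + 2)) (AdeleRing (𝓞 L) L)) : ℝ)), hFg]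
    exact prod_le_finprod_of_one_le (GLn.hasFiniteMulSupport_localHeight _) (fun w' => by exact_mod_cast GLn.one_le_localHeight w' _) _
  set y : Fp L := ((d * d₀ : ℕ) : Fp L) * τ with hydef
  have hy0 : y ≠ 0 := mul_ne_zero (by exact_mod_cast hdd₀) hτ0
  have hnint : IsIntegral ℤ (((d * d₀ : ℕ) : Fp L)) := by
    have h' : IsIntegral ℤ (algebraMap ℤ (Fp L) ((d * d₀ : ℕ) : ℤ)) := isIntegral_algebraMap
    rwa [map_natCast] at h'
  have hval : ∀ v ∈ T S h, Valued.v (y : v.adicCompletion (Fp L)) ≤ WithZero.exp (-(mτ S v : ℤ)) := by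
    intro v _
    have hyle : v.valuation (Fp L) y ≤ 1 := valuation_le_one_of_isIntegral (Fp L) v hyint
    have hx0 : v.valuation (Fp L) τ ≠ 0 := (Valuation.ne_zero_iff _).2 hτ0
    rw [HeightOneSpectrum.valuedAdicCompletion_eq_valuation']
    by_cases hle : v.valuation (Fp L) τ ≤ 1
    · -- `|τ|_v ≤ 1`: `q_v^{−mτ} = |τ|_v ≥ |y|_v` (as in ★ (L5-den))
      have hlog : WithZero.log (v.valuation (Fp L) τ) ≤ 0 := (WithZero.log_le_iff_le_exp hx0).2 (by rwa [WithZero.exp_zero])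
      have hm : ((mτ S v : ℕ) : ℤ) = -WithZero.log (v.valuation (Fp L) τ) := by
        rw [hmτ S v, HeightOneSpectrum.algebraMap_adicCompletion, Function.comp_apply, Algebra.algebraMap_self_apply,
          HeightOneSpectrum.valuedAdicCompletion_eq_valuation', Int.toNat_of_nonneg (neg_nonneg.2 hlog)]
      have hDle : v.valuation (Fp L) (((d * d₀ : ℕ) : Fp L)) ≤ 1 := valuation_le_one_of_isIntegral (Fp L) v hnint
      rw [hydef, map_mul]
      calc v.valuation (Fp L) (((d * d₀ : ℕ) : Fp L)) * v.valuation (Fp L) τ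
          ≤ 1 * v.valuation (Fp L) τ := mul_le_mul_left hDle _
        _ = WithZero.exp (-(mτ S v : ℤ)) := by rw [one_mul, hm, neg_neg, WithZero.exp_log hx0]
    · -- `|τ|_v > 1`: `mτ S v = 0` and `|y|_v ≤ 1`
      have hlt : 1 < v.valuation (Fp L) τ := not_le.1 hle
      have hlog : 0 < WithZero.log (v.valuation (Fp L) τ) := by
        rw [WithZero.lt_log_iff_exp_lt hx0, WithZero.exp_zero]
        exact hlt
      have hm : mτ S v = 0 := by
        rw [hmτ S v, HeightOneSpectrum.algebraMap_adicCompletion, Function.comp_apply, Algebra.algebraMap_self_apply,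
          HeightOneSpectrum.valuedAdicCompletion_eq_valuation', Int.toNat_eq_zero]
        exact neg_nonpos.2 hlog.le
      rw [hm, Nat.cast_zero, neg_zero, WithZero.exp_zero]
      exact hyle
  have hprod : ∏ v ∈ T S h, ((v.residueCard : ℕ) : ℝ) ^ mτ S v ≤ |((Algebra.norm ℚ y : ℚ) : ℝ)| :=
    prod_pow_absNorm_le_abs_norm_of_valuation_le (Fp L) y hy0 hyint (T S h) (mτ S) hval
  have hentry : ∀ w₁ : NumberField.InfinitePlace L, w₁ ((S : Matrix (Fin 2) (Fin 2) L) ip ip) ≤ τa S := by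
    intro w₁
    rw [← NumberField.mixedEmbedding.normAtPlace_apply w₁ ((S : Matrix (Fin 2) (Fin 2) L) ip ip)]
    have h1 : NumberField.mixedEmbedding.normAtPlace w₁ (NumberField.mixedEmbedding L ((S : Matrix (Fin 2) (Fin 2) L) ip ip)) ≤
        ‖NumberField.mixedEmbedding L ((S : Matrix (Fin 2) (Fin 2) L) ip ip)‖ := by
      rw [NumberField.mixedEmbedding.norm_eq_sup'_normAtPlace]
      exact Finset.le_sup' (fun w₂ => NumberField.mixedEmbedding.normAtPlace w₂ (NumberField.mixedEmbedding L ((S : Matrix (Fin 2) (Fin 2) L) ip ip)))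
        (Finset.mem_univ w₁)
    have h2 : ‖NumberField.mixedEmbedding L ((S : Matrix (Fin 2) (Fin 2) L) ip ip)‖ ≤ ‖(fun a b => NumberField.mixedEmbedding L ((S : Matrix (Fin 2) (Fin 2) L) a b))‖ :=
      (norm_le_pi_norm ((fun a b => NumberField.mixedEmbedding L ((S : Matrix (Fin 2) (Fin 2) L) a b)) ip) ip).trans
        (norm_le_pi_norm (fun a b => NumberField.mixedEmbedding L ((S : Matrix (Fin 2) (Fin 2) L) a b)) ip)
    exact h1.trans (h2.trans (hτa S))
  have hnormy : |((Algebra.norm ℚ y : ℚ) : ℝ)| ≤ (((d * d₀ : ℕ) : ℝ) * (Cτ * τa S)) ^ nF := by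
    refine abs_norm_le_pow_of_apply_le (Fp L) y fun w₁ => ?_
    rw [hydef, map_mul, ← NumberField.InfinitePlace.norm_embedding_eq w₁ (((d * d₀ : ℕ) : Fp L)), map_natCast, Complex.norm_natCast]
    exact mul_le_mul_of_nonneg_left (harch (τa S) hentry w₁) (Nat.cast_nonneg _)
  have hX2 : ∏ v ∈ T S h, ((v.residueCard : ℕ) : ℝ) ^ mτ S v ≤ (((d : ℝ) * t) * ((d₀ : ℝ) * (Cτ + 1))) ^ nF := by
    refine (hprod.trans hnormy).trans (pow_le_pow_left₀ (mul_nonneg (Nat.cast_nonneg _) (mul_nonneg hCτ hτa0)) ?_ _)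
    push_cast
    rw [ht]
    nlinarith [mul_nonneg (Nat.cast_nonneg d : (0:ℝ) ≤ d) (Nat.cast_nonneg d₀ : (0:ℝ) ≤ d₀), hCτ, hτa0,
      mul_nonneg (mul_nonneg (Nat.cast_nonneg d : (0:ℝ) ≤ d) (Nat.cast_nonneg d₀ : (0:ℝ) ≤ d₀)) hτa0,
      mul_nonneg (mul_nonneg (Nat.cast_nonneg d : (0:ℝ) ≤ d) (Nat.cast_nonneg d₀ : (0:ℝ) ≤ d₀)) hCτ]
  have hq1 : ∀ v : HeightOneSpectrum (𝓞 (Fp L)), (1 : ℝ) ≤ ((v.residueCard : ℕ) : ℝ) := fun v => by exact_mod_cast v.one_lt_residueCard.le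
  have hPol : ∏ v ∈ (T S h).filter (fun v => 1 < Valued.v (algebraMap (Fp L) (v.adicCompletion (Fp L)) τ)), ((v.residueCard : ℕ) : ℝ) ≤
      ((d * d₀ : ℕ) : ℝ) ^ nF := by
    have hdvd : ∀ v ∈ (T S h).filter (fun v => 1 < Valued.v (algebraMap (Fp L) (v.adicCompletion (Fp L)) τ)),
        v.asIdeal ∣ Ideal.span {((d * d₀ : ℕ) : 𝓞 (Fp L))} := by
      intro v hv
      have h1 : 1 < v.valuation (Fp L) τ := by
        have h' := (Finset.mem_filter.1 hv).2
        rwa [HeightOneSpectrum.algebraMap_adicCompletion, Function.comp_apply, Algebra.algebraMap_self_apply,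
          HeightOneSpectrum.valuedAdicCompletion_eq_valuation'] at h'
      have hlt := K2LiuKindWPlacesCount.valuation_natCast_lt_one_of_one_lt (Fp L) v hyint h1
      rw [show (((d * d₀ : ℕ) : ℕ) : Fp L) = algebraMap (𝓞 (Fp L)) (Fp L) ((d * d₀ : ℕ) : 𝓞 (Fp L)) by rw [map_natCast]] at hlt
      exact (HeightOneSpectrum.valuation_lt_one_iff_dvd v _).1 hlt
    have hNP := prod_absNorm_le_pow_of_natCast hdd₀ _ hdvd
    have h' : ∏ v ∈ (T S h).filter (fun v => 1 < Valued.v (algebraMap (Fp L) (v.adicCompletion (Fp L)) τ)), ((v.residueCard : ℕ) : ℝ) =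
        ((∏ v ∈ (T S h).filter (fun v => 1 < Valued.v (algebraMap (Fp L) (v.adicCompletion (Fp L)) τ)), Ideal.absNorm v.asIdeal : ℕ) : ℝ) := by
      push_cast
      rfl
    rw [h']
    exact_mod_cast hNP
  have hMov := prod_residueCard_kindWFinset_sdiff_le L e dV hdV dW hdW (T₀ ∪ Tp S) (Matrix.single 1 1 (σc S)) (gc S * h) hdd₁
    (fun a b => by
      rw [Matrix.single_apply]
      split_ifs
      · exact hσint
      · rw [mul_zero]; exact isIntegral_zero)
    (fun a b => by rw [inv_single_eq_zero, Matrix.zero_apply, mul_zero]; exact isIntegral_zero)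
  have hcover : T S h ⊆ ((T₀ ∪ Trec) ∪ (T S h).filter (fun v => 1 < Valued.v (algebraMap (Fp L) (v.adicCompletion (Fp L)) τ)) ∪
      (kindWFinset L e dV hdV dW hdW (T₀ ∪ Tp S) (Matrix.single 1 1 (σc S)) (gc S * h) \ (T₀ ∪ Tp S))) := by
    intro v hv
    rw [Finset.mem_union, Finset.mem_union, Finset.mem_union, Finset.mem_filter, Finset.mem_sdiff, Finset.mem_union, ← hTeq]
    by_cases hv0 : v ∈ T₀
    · exact Or.inl (Or.inl (Or.inl hv0))
    · by_cases hvT : v ∈ Tp S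
      · rcases (hTp S v).1 hvT with h' | h'
        · exact Or.inl (Or.inl (Or.inr h'))
        · exact Or.inl (Or.inr ⟨hv, h'⟩)
      · exact Or.inr ⟨hv, not_or.2 ⟨hv0, hvT⟩⟩
  have hX1 : ∏ v ∈ T S h, ((v.residueCard : ℕ) : ℝ) ≤ Qrec * ((d * d₀ : ℕ) : ℝ) ^ nF * (Fg * HΔ * ((d * d₁ : ℕ) : ℝ) ^ (2 * nL)) := by
    calc ∏ v ∈ T S h, ((v.residueCard : ℕ) : ℝ)
        ≤ ∏ v ∈ ((T₀ ∪ Trec) ∪ (T S h).filter (fun v => 1 < Valued.v (algebraMap (Fp L) (v.adicCompletion (Fp L)) τ)) ∪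
            (kindWFinset L e dV hdV dW hdW (T₀ ∪ Tp S) (Matrix.single 1 1 (σc S)) (gc S * h) \ (T₀ ∪ Tp S))), ((v.residueCard : ℕ) : ℝ) :=
          Finset.prod_le_prod_of_subset_of_one_le hcover (fun v _ => zero_le_one.trans (hq1 v)) fun v _ _ => hq1 v
      _ ≤ (∏ v ∈ (T₀ ∪ Trec) ∪ (T S h).filter (fun v => 1 < Valued.v (algebraMap (Fp L) (v.adicCompletion (Fp L)) τ)), ((v.residueCard : ℕ) : ℝ)) *
            ∏ v ∈ kindWFinset L e dV hdV dW hdW (T₀ ∪ Tp S) (Matrix.single 1 1 (σc S)) (gc S * h) \ (T₀ ∪ Tp S), ((v.residueCard : ℕ) : ℝ) :=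
          prod_union_le_of_one_le hq1 _ _
      _ ≤ (Qrec * ∏ v ∈ (T S h).filter (fun v => 1 < Valued.v (algebraMap (Fp L) (v.adicCompletion (Fp L)) τ)), ((v.residueCard : ℕ) : ℝ)) *
            ∏ v ∈ kindWFinset L e dV hdV dW hdW (T₀ ∪ Tp S) (Matrix.single 1 1 (σc S)) (gc S * h) \ (T₀ ∪ Tp S), ((v.residueCard : ℕ) : ℝ) :=
          mul_le_mul_of_nonneg_right (prod_union_le_of_one_le hq1 _ _) (Finset.prod_nonneg fun _ _ => Nat.cast_nonneg _)
      _ ≤ (Qrec * ((d * d₀ : ℕ) : ℝ) ^ nF) * (Fg * HΔ * ((d * d₁ : ℕ) : ℝ) ^ (2 * nL)) := by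
          refine mul_le_mul (mul_le_mul_of_nonneg_left hPol (zero_le_one.trans hQrec1)) ?_ (Finset.prod_nonneg fun _ _ => Nat.cast_nonneg _) (by positivity)
          rw [hFg, hHΔ, hnL]
          exact hMov
  have hplace := hGn S s hs h hS0 hdet i hi
  have hP : ‖∏ v ∈ T S h, Gn S i v s h‖ ≤
      ((∏ v ∈ T S h, ((v.residueCard : ℕ) : ℝ) ^ mτ S v) * (∏ v ∈ T S h, ((v.residueCard : ℕ) : ℝ)) *
        ∏ v ∈ T S h, ∏ w' : UnitaryGroup.PlacesOver L v,
          (GLn.localHeight (2 + 2) L w'.1 ((gc S * h : HA L e dV hdV dW hdW) : GL (Fin (2 + 2)) (AdeleRing (𝓞 L) L)) : ℝ)) ^ Mv := by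
    rw [norm_prod]
    calc ∏ v ∈ T S h, ‖Gn S i v s h‖
        ≤ ∏ v ∈ T S h, ((((v.residueCard : ℕ) : ℝ) ^ (mτ S v + 1)) *
            ∏ w' : UnitaryGroup.PlacesOver L v, (GLn.localHeight (2 + 2) L w'.1 ((gc S * h : HA L e dV hdV dW hdW) : GL (Fin (2 + 2)) (AdeleRing (𝓞 L) L)) : ℝ)) ^ Mv :=
          Finset.prod_le_prod (fun v _ => norm_nonneg _) fun v hv => hplace v hv
      _ = _ := by
          have hsplit : ∏ v ∈ T S h, ((((v.residueCard : ℕ) : ℝ) ^ (mτ S v + 1)) *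
              ∏ w' : UnitaryGroup.PlacesOver L v, (GLn.localHeight (2 + 2) L w'.1 ((gc S * h : HA L e dV hdV dW hdW) : GL (Fin (2 + 2)) (AdeleRing (𝓞 L) L)) : ℝ)) =
              (∏ v ∈ T S h, ((v.residueCard : ℕ) : ℝ) ^ mτ S v) * (∏ v ∈ T S h, ((v.residueCard : ℕ) : ℝ)) *
                ∏ v ∈ T S h, ∏ w' : UnitaryGroup.PlacesOver L v,
                  (GLn.localHeight (2 + 2) L w'.1 ((gc S * h : HA L e dV hdV dW hdW) : GL (Fin (2 + 2)) (AdeleRing (𝓞 L) L)) : ℝ) := by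
            have hq : ∏ v ∈ T S h, ((v.residueCard : ℕ) : ℝ) ^ (mτ S v + 1) =
                (∏ v ∈ T S h, ((v.residueCard : ℕ) : ℝ) ^ mτ S v) * ∏ v ∈ T S h, ((v.residueCard : ℕ) : ℝ) := by
              rw [← Finset.prod_mul_distrib]
              exact Finset.prod_congr rfl fun v _ => pow_succ _ _
            rw [Finset.prod_mul_distrib, hq]
          rw [Finset.prod_pow, hsplit]
  have hX0 : 0 ≤ (∏ v ∈ T S h, ((v.residueCard : ℕ) : ℝ) ^ mτ S v) * (∏ v ∈ T S h, ((v.residueCard : ℕ) : ℝ)) *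
      ∏ v ∈ T S h, ∏ w' : UnitaryGroup.PlacesOver L v,
        (GLn.localHeight (2 + 2) L w'.1 ((gc S * h : HA L e dV hdV dW hdW) : GL (Fin (2 + 2)) (AdeleRing (𝓞 L) L)) : ℝ) :=
    mul_nonneg (mul_nonneg (Finset.prod_nonneg fun _ _ => pow_nonneg (Nat.cast_nonneg _) _) (Finset.prod_nonneg fun _ _ => Nat.cast_nonneg _))
      (Finset.prod_nonneg fun _ _ => Finset.prod_nonneg fun _ _ => NNReal.coe_nonneg _)
  have hbig : (∏ v ∈ T S h, ((v.residueCard : ℕ) : ℝ) ^ mτ S v) * (∏ v ∈ T S h, ((v.residueCard : ℕ) : ℝ)) *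
      (∏ v ∈ T S h, ∏ w' : UnitaryGroup.PlacesOver L v,
        (GLn.localHeight (2 + 2) L w'.1 ((gc S * h : HA L e dV hdV dW hdW) : GL (Fin (2 + 2)) (AdeleRing (𝓞 L) L)) : ℝ)) ≤
      Cst * Hh ^ 2 * t ^ (nF + 2 * kk) * (d : ℝ) ^ (2 * nF + 2 * nL + 2 * kk) := by
    have h3 : (∏ v ∈ T S h, ((v.residueCard : ℕ) : ℝ) ^ mτ S v) * (∏ v ∈ T S h, ((v.residueCard : ℕ) : ℝ)) *
        (∏ v ∈ T S h, ∏ w' : UnitaryGroup.PlacesOver L v,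
          (GLn.localHeight (2 + 2) L w'.1 ((gc S * h : HA L e dV hdV dW hdW) : GL (Fin (2 + 2)) (AdeleRing (𝓞 L) L)) : ℝ)) ≤
        (((d : ℝ) * t) * ((d₀ : ℝ) * (Cτ + 1))) ^ nF * (Qrec * ((d * d₀ : ℕ) : ℝ) ^ nF * (Fb * HΔ * ((d * d₁ : ℕ) : ℝ) ^ (2 * nL))) * Fb := by
      refine mul_le_mul (mul_le_mul hX2 (hX1.trans ?_) (Finset.prod_nonneg fun _ _ => Nat.cast_nonneg _) (by positivity)) (hX3.trans hF)
        (Finset.prod_nonneg fun _ _ => Finset.prod_nonneg fun _ _ => NNReal.coe_nonneg _) (by positivity)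
      exact mul_le_mul_of_nonneg_left (mul_le_mul_of_nonneg_right (mul_le_mul_of_nonneg_right hF hHΔ0) (by positivity)) (by positivity)
    refine h3.trans (le_of_eq ?_)
    rw [hCst, hFb, mul_pow ((d : ℝ) * t) ((d₀ : ℝ) * (Cτ + 1)) nF, mul_pow (d : ℝ) t nF]
    push_cast
    ring
  have hfinal : ‖∏ v ∈ T S h, Gn S i v s h‖ ≤ (Cst * Hh ^ 2 * t ^ (nF + 2 * kk) * (d : ℝ) ^ (2 * nF + 2 * nL + 2 * kk)) ^ Mv :=
    hP.trans (pow_le_pow_left₀ hX0 hbig Mv)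
  rw [show ((2 * Mv : ℕ) : ℝ) = ((2 * Mv : ℕ) : ℝ) from rfl, Real.rpow_natCast]
  calc ‖∏ v ∈ T S h, Gn S i v s h‖ ≤ (Cst * Hh ^ 2 * t ^ (nF + 2 * kk) * (d : ℝ) ^ (2 * nF + 2 * nL + 2 * kk)) ^ Mv := hfinal
    _ = Cst ^ Mv * Hh ^ (2 * Mv) * t ^ (Mv * (nF + 2 * kk)) * (d : ℝ) ^ (Mv * (2 * nF + 2 * nL + 2 * kk)) := by
        rw [mul_pow, mul_pow, mul_pow, ← pow_mul, ← pow_mul, ← pow_mul]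
        ring_nf

end Head

end Summit.HodgeConjecture.HodgeConjecture.Cruxes.HLiu418.K2LiuKindOneSingularFiniteHeadBound

end
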